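import Summits.KontsevichZagierPeriods.KontsevichZagierPeriods.Theorems.ValuedFieldSpecialisationCTConstructionBlowupBinomial
import Summits.KontsevichZagierPeriods.KontsevichZagierPeriods.Theorems.ValuedFieldSpecialisationCTConstructionBlowupPlumbing
import Summits.KontsevichZagierPeriods.KontsevichZagierPeriods.Theorems.ValuedFieldSpecialisationCTConstructionLogFamilyWeightedTotal

/-!
# Route ValuedFieldSpecialisation — crux `CTConstruction`: `T = 2β − 1` is nilpotent on the log block

Helper toward crux stmt-KontsevichZagierPeriods-3495 (`CTConstruction`), line `registered`, reshape r4
(blow-up elimination of the log block; lead file). With `β = FreeAbelianGroup.lift Tβ` the blow-up and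
`T x = 2 • β x − x` (`…BlowupPlumbing`), the binomial law (`…BlowupBinomial`) for a PURE-LOG elementary
divergent product `P = P(0, q, b, r)` reads `β [P] ≡ Σₙ (b choose n) • [P'ₙ]` with `P'ₙ` of level
`b − n` over the fibre representation `Wₙ(r)`, and its diagonal term satisfies `2 • [P'₀] ≡ [P]`; so
modulo fibred relations `T [P] ≡ Σ_{n ≥ 1} 2 (b choose n) • [P'ₙ]` only LOWERS the level. Hence
(`blowupT_iterate_log`, induction on `m`):

* `T^[m] [P] ∈ fibredRelations` for every pure-log `P` of level `b < m`;
* for `P` of level exactly `m`, `T^[m] [P] ≡ (2^m · m!) • [C]` where `C` is the CONSTANT family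
  (level `0`) over a representation `W` with `4^m • [W] − [r] ∈ KZ.relations` (the only surviving chain
  lowers the level by one at each step, through the fibre representation `W₁`, whose class is `¼` of its
  base: `four_nsmul_of_fibreRep_one_sub_of_mem_relations`, from cycle 2's `stub_logFamily_weighted_total`).

For POWER generators (`0 < p < q`) no identity is needed: `β`, hence `T` and its iterates, map the
subgroup they generate into itself modulo fibred relations (`blowupT_iterate_pow`), all pieces of the
binomial law being power generators with the same exponent over the fibre representations.

Sources: M. Kontsevich, D. Zagier, *Periods* (2001), §1.2; the blow-up calculus is this route's.
No new definitions.
-/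

noncomputable section

namespace Summit.KontsevichZagierPeriods.ValuedFieldSpecialisation

open MeasureTheory Set Filter
open scoped Topology
open Literature.NumberTheory.Transcendental Literature.NumberTheory.Transcendental.KZ

/-! ## The class of the fibre representation `W₁` is a quarter of its base -/

/-- **`4 • [W₁] − [r] ∈ KZ.relations`** for the pure-log fibre representation `W₁ = W₁(0, q, r)`
(coordinates `(s', η, x)`, domain `0 < s' < 1`, `s' ≤ η ≤ 1`, `x ∈ r.domain`, integrand
`s' · η⁻¹ · r(x)`; `∫₀¹ s log(1/s) ds = ¼` at class level): the `s`-weighted log-family `P'` of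
`stub_logFamily_weighted_total` is `W₁.cylinder` with its first two coordinates swapped
(`KZ.of_sub_of_reindex_mem_relations`, `of_cylinder_sub_of_mem_relations`).
[Kontsevich–Zagier 2001, §1.2] [folklore] -/
theorem four_nsmul_of_fibreRep_one_sub_of_mem_relations {q d : ℕ} (hq : 0 < q) (r : IntegralRep d)
    (W : IntegralRep (1 + d + 1))
    (hWd : W.domain = {v | ∃ (s' : ℝ) (η : Fin 1 → ℝ) (x : Fin d → ℝ),
      v = Matrix.vecCons s' (Fin.append η x) ∧ 0 < s' ∧ s' < 1 ∧ (∀ l, s' ≤ η l ∧ η l ≤ 1) ∧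
        x ∈ r.domain})
    (hWi : W.integrand = fun v => v 0 ^ ((1 - ((0 : ℕ) : ℚ) / q : ℚ) : ℝ) *
      ((∏ l : Fin 1, (v (Fin.castAdd d l).succ)⁻¹) * r.integrand (fun i : Fin d => v (Fin.natAdd 1 i).succ))) :
    4 • of W - of r ∈ relations := by
  obtain ⟨P, hPd, hPi⟩ := exists_elementaryRep (p := 0) (q := q) (b := 1) hq r
  set e : Fin (1 + d + 1 + 1) ≃ Fin (1 + d + 1 + 1) := Equiv.swap 0 1 with he
  set P' : IntegralRep (1 + d + 1 + 1) := W.cylinder.reindex e with hP'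
  have he0 : e 0 = 1 := by rw [he, Equiv.swap_apply_left]
  have he1 : e 1 = 0 := by rw [he, Equiv.swap_apply_right]
  have hess : ∀ k : Fin (1 + d), e k.succ.succ = k.succ.succ := fun k =>
    Equiv.swap_apply_of_ne_of_ne (succ_succ_ne_zero k) (succ_succ_ne_one k)
  have hexp : (((1 - ((0 : ℕ) : ℚ) / q : ℚ)) : ℝ) = 1 := by push_cast; ring
  have hsucc0 : e (Fin.succ (0 : Fin (1 + d + 1))) = 0 := by
    rw [show Fin.succ (0 : Fin (1 + d + 1)) = (1 : Fin (1 + d + 1 + 1)) from Fin.ext (by simp), he1]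
  rw [monomialDomain_eq 1 r] at hWd
  have hPd' := hPd
  rw [elementaryDomain_eq 0 q 1 r] at hPd'
  -- membership in `P'.domain`, read in coordinates
  have hA : ∀ w' : Fin (1 + d + 1 + 1) → ℝ, w' ∈ P'.domain ↔
      (0 < w' 1 ∧ w' 1 < 1 ∧ (0 < w' 0 ∧ w' 0 < 1 ∧
        (∀ j : Fin 1, w' 0 ≤ w' (Fin.castAdd d j).succ.succ ∧ w' (Fin.castAdd d j).succ.succ ≤ 1) ∧
        (fun l : Fin d => w' (Fin.natAdd 1 l).succ.succ) ∈ r.domain)) := by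
    intro w'
    simp only [hP', IntegralRep.reindex_domain, IntegralRep.domain_cylinder, IntegralRep.cylinderDomain,
      mem_setOf_eq, hWd, he0, hsucc0, hess]
  have hB : ∀ w' : Fin (1 + d + 1 + 1) → ℝ, w' ∈ P.domain ∩ paramSlab (1 + d + 1) 0 1 ↔
      ((0 < w' 0 ∧ w' 0 < 1 ∧ 0 < w' 1 ∧ w' 1 ^ q * w' 0 ^ 0 < 1 ∧
        (∀ j : Fin 1, w' 0 ≤ w' (Fin.castAdd d j).succ.succ ∧ w' (Fin.castAdd d j).succ.succ ≤ 1) ∧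
        (fun l : Fin d => w' (Fin.natAdd 1 l).succ.succ) ∈ r.domain) ∧ (0 < w' 0 ∧ w' 0 < 1)) := by
    intro w'
    simp only [hPd', mem_inter_iff, mem_setOf_eq, mem_paramSlab, Rat.cast_zero, Rat.cast_one]
  have hP'd : P'.domain = P.domain ∩ paramSlab (1 + d + 1) 0 1 := by
    ext w'
    rw [hA, hB]
    constructor
    · rintro ⟨hu0, hu1, hs0, hs1, hy, hw⟩
      exact ⟨⟨hs0, hs1, hu0, by rw [pow_zero, mul_one]; exact (pow_lt_one_iff_of_nonneg hu0.le hq.ne').mpr hu1,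
        hy, hw⟩, hs0, hs1⟩
    · rintro ⟨⟨hs0, hs1, hu0, huq, hy, hw⟩, -, -⟩
      rw [pow_zero, mul_one] at huq
      exact ⟨hu0, (pow_lt_one_iff_of_nonneg hu0.le hq.ne').mp huq, hs0, hs1, hy, hw⟩
  have hP'i : P'.integrand = fun z => z 0 ^ 1 * P.integrand z := by
    funext w'
    simp only [hP', IntegralRep.reindex_integrand, IntegralRep.integrand_cylinder, hWi, hPi, hexp,
      Real.rpow_one, pow_one, hsucc0, hess]
  have h1 : 4 • of P' - of r ∈ relations := stub_logFamily_weighted_total q d r P P' hq hPd hPi hP'd hP'i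
  have h2 : of W.cylinder - of P' ∈ relations := of_sub_of_reindex_mem_relations W.cylinder e
  have h3 : of W.cylinder - of W ∈ relations := of_cylinder_sub_of_mem_relations W
  have : 4 • of W - of r = 4 • ((of W.cylinder - of P') - (of W.cylinder - of W)) + (4 • of P' - of r) := by
    abel
  rw [this]
  exact relations.add_mem (relations.nsmul_mem (relations.sub_mem h2 h3) 4) h1

/-! ## Nilpotence of `T` on the log block -/

section Nilpotence

variable {Tβ : (Σ n, IntegralRep n) → FormalRep}
  (hT0 : ∀ ρ : IntegralRep 0, Tβ ⟨0, ρ⟩ = 0)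
  (hT : ∀ (n : ℕ) (ρ : IntegralRep (n + 1)), ∃ ρ' : IntegralRep (n + 1 + 1), Tβ ⟨n + 1, ρ⟩ = of ρ' ∧
    ρ'.domain = {z | 0 < z 1 ∧ z 1 < z 0 ∧ z 0 < 1 ∧ (fun i : Fin (n + 1) => z i.succ) ∈ ρ.domain} ∧
    ρ'.integrand = fun z => z 1 / z 0 ^ 2 * ρ.integrand (fun i : Fin (n + 1) => z i.succ))

include hT in
/-- **`T` lowers the level of a pure-log elementary product.** For `P = P(0, q, b, r)`:
`T [P] ≡ Σ_{k < b} 2 (b choose (k+1)) • [P'_{k+1}]` modulo fibred relations, where `P'ₙ` is the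
elementary product of level `b − n` over the fibre representation `Wₙ(r)` (binomial law with the
diagonal term removed, `two_nsmul_of_sub_of_mem_fibredRelations_of_diag`). [folklore] -/
theorem blowupT_log_lower {q b d : ℕ} (hq : 0 < q) (r : IntegralRep d) (P : IntegralRep (b + d + 1 + 1))
    (hPd : P.domain = {z | ∃ (s u : ℝ) (y : Fin b → ℝ) (w : Fin d → ℝ),
      z = Matrix.vecCons s (Matrix.vecCons u (Fin.append y w)) ∧ 0 < s ∧ s < 1 ∧ 0 < u ∧
        u ^ q * s ^ 0 < 1 ∧ (∀ j, s ≤ y j ∧ y j ≤ 1) ∧ w ∈ r.domain})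
    (hPi : P.integrand = fun z => (∏ j : Fin b, (z (Fin.castAdd d j).succ.succ)⁻¹) *
      r.integrand (fun l : Fin d => z (Fin.natAdd b l).succ.succ)) :
    ∃ (W : (n : ℕ) → IntegralRep (n + d + 1)) (P' : (n : ℕ) → IntegralRep (b - n + (n + d + 1) + 1 + 1)),
      (∀ n, (W n).domain = {v | ∃ (s' : ℝ) (η : Fin n → ℝ) (x : Fin d → ℝ),
          v = Matrix.vecCons s' (Fin.append η x) ∧ 0 < s' ∧ s' < 1 ∧ (∀ l, s' ≤ η l ∧ η l ≤ 1) ∧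
            x ∈ r.domain} ∧
        (W n).integrand = fun v => v 0 ^ ((1 - ((0 : ℕ) : ℚ) / q : ℚ) : ℝ) *
          ((∏ l : Fin n, (v (Fin.castAdd d l).succ)⁻¹) * r.integrand (fun i : Fin d => v (Fin.natAdd n i).succ))) ∧
      (∀ n, (P' n).domain = {z | ∃ (s u : ℝ) (y : Fin (b - n) → ℝ) (w : Fin (n + d + 1) → ℝ),
          z = Matrix.vecCons s (Matrix.vecCons u (Fin.append y w)) ∧ 0 < s ∧ s < 1 ∧ 0 < u ∧
            u ^ q * s ^ 0 < 1 ∧ (∀ j, s ≤ y j ∧ y j ≤ 1) ∧ w ∈ (W n).domain} ∧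
        (P' n).integrand = fun z => (∏ j : Fin (b - n), (z (Fin.castAdd (n + d + 1) j).succ.succ)⁻¹) *
          (W n).integrand (fun l : Fin (n + d + 1) => z (Fin.natAdd (b - n) l).succ.succ)) ∧
      (2 • FreeAbelianGroup.lift Tβ (of P) - of P) -
        ∑ k ∈ Finset.range b, (2 * b.choose (k + 1)) • of (P' (k + 1)) ∈ fibredRelations := by
  obtain ⟨W, P', hW, hP', hrel⟩ := blowup_binomial hT hq r P hPd hPi
  refine ⟨W, P', hW, hP', ?_⟩
  -- the diagonal term
  have hdiag : 2 • of (P' 0) - of P ∈ fibredRelations :=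
    two_nsmul_of_sub_of_mem_fibredRelations_of_diag hq hq (Nat.sub_zero b) r (W 0) P (P' 0) hPd hPi
      (hP' 0).1 (hP' 0).2 (two_nsmul_of_fibreRep_zero_sub_of_mem_relations r (W 0) (hW 0).1 (hW 0).2)
  have hsplit : ∑ n ∈ Finset.range (b + 1), (b.choose n) • of (P' n) =
      ∑ k ∈ Finset.range b, (b.choose (k + 1)) • of (P' (k + 1)) + of (P' 0) := by
    rw [Finset.sum_range_succ']
    simp
  have key : (2 • FreeAbelianGroup.lift Tβ (of P) - of P) -
      ∑ k ∈ Finset.range b, (2 * b.choose (k + 1)) • of (P' (k + 1)) =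
      2 • (FreeAbelianGroup.lift Tβ (of P) - ∑ n ∈ Finset.range (b + 1), (b.choose n) • of (P' n)) +
        (2 • of (P' 0) - of P) := by
    rw [hsplit, smul_sub, smul_add, Finset.smul_sum]
    simp only [mul_smul]
    abel
  rw [key]
  exact fibredRelations.add_mem (fibredRelations.nsmul_mem hrel 2) hdiag

include hT0 hT in
/-- **Nilpotence of `T = 2β − 1` on the log block** (see the module docstring): by induction on `m`,
(1) `T^[m] [P]` is a fibred relation for every pure-log elementary product `P` of level `b < m`, and
(2) for `P` of level `b = m`, `T^[m] [P] ≡ (2^m · m!) • [C]` for a constant family `C` over a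
representation `W` with `4^m • [W] − [r] ∈ relations`. [folklore] -/
theorem blowupT_iterate_log (m : ℕ) :
    (∀ (b q d : ℕ) (r : IntegralRep d) (P : IntegralRep (b + d + 1 + 1)), b < m → 0 < q →
      P.domain = {z | ∃ (s u : ℝ) (y : Fin b → ℝ) (w : Fin d → ℝ),
        z = Matrix.vecCons s (Matrix.vecCons u (Fin.append y w)) ∧ 0 < s ∧ s < 1 ∧ 0 < u ∧
          u ^ q * s ^ 0 < 1 ∧ (∀ j, s ≤ y j ∧ y j ≤ 1) ∧ w ∈ r.domain} →
      P.integrand = (fun z => (∏ j : Fin b, (z (Fin.castAdd d j).succ.succ)⁻¹) *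
        r.integrand (fun l : Fin d => z (Fin.natAdd b l).succ.succ)) →
      (fun x => 2 • FreeAbelianGroup.lift Tβ x - x)^[m] (of P) ∈ fibredRelations) ∧
    (∀ (b q d : ℕ) (r : IntegralRep d) (P : IntegralRep (b + d + 1 + 1)), b = m → 0 < q →
      P.domain = {z | ∃ (s u : ℝ) (y : Fin b → ℝ) (w : Fin d → ℝ),
        z = Matrix.vecCons s (Matrix.vecCons u (Fin.append y w)) ∧ 0 < s ∧ s < 1 ∧ 0 < u ∧
          u ^ q * s ^ 0 < 1 ∧ (∀ j, s ≤ y j ∧ y j ≤ 1) ∧ w ∈ r.domain} →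
      P.integrand = (fun z => (∏ j : Fin b, (z (Fin.castAdd d j).succ.succ)⁻¹) *
        r.integrand (fun l : Fin d => z (Fin.natAdd b l).succ.succ)) →
      ∃ (d' : ℕ) (W : IntegralRep d') (C : IntegralRep (0 + d' + 1 + 1)),
        C.domain = {z | ∃ (s u : ℝ) (y : Fin 0 → ℝ) (w : Fin d' → ℝ),
          z = Matrix.vecCons s (Matrix.vecCons u (Fin.append y w)) ∧ 0 < s ∧ s < 1 ∧ 0 < u ∧
            u ^ q * s ^ 0 < 1 ∧ (∀ j, s ≤ y j ∧ y j ≤ 1) ∧ w ∈ W.domain} ∧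
        C.integrand = (fun z => (∏ j : Fin 0, (z (Fin.castAdd d' j).succ.succ)⁻¹) *
          W.integrand (fun l : Fin d' => z (Fin.natAdd 0 l).succ.succ)) ∧
        (fun x => 2 • FreeAbelianGroup.lift Tβ x - x)^[m] (of P) - (2 ^ m * m.factorial) • of C ∈
          fibredRelations ∧
        4 ^ m • of W - of r ∈ relations) := by
  induction m with
  | zero =>
    refine ⟨fun b q d r P hb => absurd hb (Nat.not_lt_zero b), fun b q d r P hb hq hPd hPi => ?_⟩
    subst hb
    refine ⟨d, r, P, hPd, hPi, ?_, ?_⟩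
    · simp [fibredRelations.zero_mem]
    · simp [relations.zero_mem]
  | succ m ih =>
    obtain ⟨ih1, ih2⟩ := ih
    -- one application of `T` lowers the level; then the induction hypotheses
    have step : ∀ (b q d : ℕ) (r : IntegralRep d) (P : IntegralRep (b + d + 1 + 1)), b ≤ m + 1 → 0 < q →
        P.domain = {z | ∃ (s u : ℝ) (y : Fin b → ℝ) (w : Fin d → ℝ),
          z = Matrix.vecCons s (Matrix.vecCons u (Fin.append y w)) ∧ 0 < s ∧ s < 1 ∧ 0 < u ∧
            u ^ q * s ^ 0 < 1 ∧ (∀ j, s ≤ y j ∧ y j ≤ 1) ∧ w ∈ r.domain} →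
        P.integrand = (fun z => (∏ j : Fin b, (z (Fin.castAdd d j).succ.succ)⁻¹) *
          r.integrand (fun l : Fin d => z (Fin.natAdd b l).succ.succ)) →
        ∃ (W : (n : ℕ) → IntegralRep (n + d + 1)) (P' : (n : ℕ) → IntegralRep (b - n + (n + d + 1) + 1 + 1)),
          (∀ n, (W n).domain = {v | ∃ (s' : ℝ) (η : Fin n → ℝ) (x : Fin d → ℝ),
              v = Matrix.vecCons s' (Fin.append η x) ∧ 0 < s' ∧ s' < 1 ∧ (∀ l, s' ≤ η l ∧ η l ≤ 1) ∧
                x ∈ r.domain} ∧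
            (W n).integrand = fun v => v 0 ^ ((1 - ((0 : ℕ) : ℚ) / q : ℚ) : ℝ) *
              ((∏ l : Fin n, (v (Fin.castAdd d l).succ)⁻¹) * r.integrand (fun i : Fin d => v (Fin.natAdd n i).succ))) ∧
          (∀ n, (P' n).domain = {z | ∃ (s u : ℝ) (y : Fin (b - n) → ℝ) (w : Fin (n + d + 1) → ℝ),
              z = Matrix.vecCons s (Matrix.vecCons u (Fin.append y w)) ∧ 0 < s ∧ s < 1 ∧ 0 < u ∧
                u ^ q * s ^ 0 < 1 ∧ (∀ j, s ≤ y j ∧ y j ≤ 1) ∧ w ∈ (W n).domain} ∧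
            (P' n).integrand = fun z => (∏ j : Fin (b - n), (z (Fin.castAdd (n + d + 1) j).succ.succ)⁻¹) *
              (W n).integrand (fun l : Fin (n + d + 1) => z (Fin.natAdd (b - n) l).succ.succ)) ∧
          (fun x => 2 • FreeAbelianGroup.lift Tβ x - x)^[m + 1] (of P) -
            (if b = m + 1 then (2 * (m + 1)) • (fun x => 2 • FreeAbelianGroup.lift Tβ x - x)^[m] (of (P' 1))
              else 0) ∈ fibredRelations := by
      intro b q d r P hb hq hPd hPi
      obtain ⟨W, P', hW, hP', hrel⟩ := blowupT_log_lower hT hq r P hPd hPi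
      refine ⟨W, P', hW, hP', ?_⟩
      -- `T^[m+1] [P] = T^[m] (T [P]) ≡ Σ_k 2 C(b, k+1) • T^[m] [P'_{k+1}]`
      have h1 : (fun x => 2 • FreeAbelianGroup.lift Tβ x - x)^[m + 1] (of P) -
          ∑ k ∈ Finset.range b, (2 * b.choose (k + 1)) •
            (fun x => 2 • FreeAbelianGroup.lift Tβ x - x)^[m] (of (P' (k + 1))) ∈ fibredRelations := by
        rw [Function.iterate_succ_apply, ← Finset.sum_congr rfl fun k _ =>
          blowupT_iterate_map_nsmul (Tβ := Tβ) m (2 * b.choose (k + 1)) (of (P' (k + 1))),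
          ← blowupT_iterate_map_sum]
        exact blowupT_iterate_sub_mem_fibredRelations hT0 hT m hrel
      -- the pieces of level `< m` die under `T^[m]`
      have h2 : ∀ k ∈ Finset.range b, k ≠ 0 ∨ b ≠ m + 1 →
          (fun x => 2 • FreeAbelianGroup.lift Tβ x - x)^[m] (of (P' (k + 1))) ∈ fibredRelations := by
        intro k hk hkb
        rw [Finset.mem_range] at hk
        refine ih1 (b - (k + 1)) q (k + 1 + d + 1) (W (k + 1)) (P' (k + 1)) ?_ hq (hP' _).1 (hP' _).2
        rcases hkb with hk0 | hbm <;> omega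
      by_cases hbm : b = m + 1
      · rw [if_pos hbm]
        subst hbm
        have hsum : ∑ k ∈ Finset.range (m + 1), (2 * (m + 1).choose (k + 1)) •
            (fun x => 2 • FreeAbelianGroup.lift Tβ x - x)^[m] (of (P' (k + 1))) -
            (2 * (m + 1)) • (fun x => 2 • FreeAbelianGroup.lift Tβ x - x)^[m] (of (P' 1)) ∈
              fibredRelations := by
          rw [Finset.sum_range_succ', Nat.choose_one_right, zero_add, add_sub_cancel_right]
          exact fibredRelations.sum_mem fun k hk =>
            fibredRelations.nsmul_mem (h2 (k + 1) (by rw [Finset.mem_range] at hk ⊢; omega) (Or.inl (by omega))) _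
        have := fibredRelations.add_mem h1 hsum
        convert this using 1
        abel
      · rw [if_neg hbm, sub_zero]
        have hsum : ∑ k ∈ Finset.range b, (2 * b.choose (k + 1)) •
            (fun x => 2 • FreeAbelianGroup.lift Tβ x - x)^[m] (of (P' (k + 1))) ∈ fibredRelations :=
          fibredRelations.sum_mem fun k hk => fibredRelations.nsmul_mem (h2 k hk (Or.inr hbm)) _
        have := fibredRelations.add_mem h1 hsum
        convert this using 1
        abel
    refine ⟨fun b q d r P hb hq hPd hPi => ?_, fun b q d r P hb hq hPd hPi => ?_⟩
    · -- (1): level `b < m + 1`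
      obtain ⟨W, P', -, -, hrel⟩ := step b q d r P hb.le hq hPd hPi
      rwa [if_neg hb.ne, sub_zero] at hrel
    · -- (2): level `b = m + 1`: the surviving chain passes through `P'₁` over `W₁`
      obtain ⟨W, P', hW, hP', hrel⟩ := step b q d r P hb.le hq hPd hPi
      rw [if_pos hb] at hrel
      obtain ⟨d', W', C, hCd, hCi, hC, hW'⟩ :=
        ih2 (b - 1) q (1 + d + 1) (W 1) (P' 1) (by omega) hq (hP' 1).1 (hP' 1).2
      refine ⟨d', W', C, hCd, hCi, ?_, ?_⟩
      · have h3 := fibredRelations.nsmul_mem hC (2 * (m + 1))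
        rw [smul_sub, ← mul_smul] at h3
        have hcoef : 2 * (m + 1) * (2 ^ m * m.factorial) = 2 ^ (m + 1) * (m + 1).factorial := by
          rw [Nat.factorial_succ, pow_succ]; ring
        rw [hcoef] at h3
        have := fibredRelations.add_mem hrel h3
        convert this using 1
        abel
      · subst hb
        have h4 : 4 • of (W 1) - of r ∈ relations :=
          four_nsmul_of_fibreRep_one_sub_of_mem_relations hq r (W 1) (hW 1).1 (hW 1).2
        have h5 := relations.nsmul_mem hW' 4
        rw [smul_sub, ← mul_smul, ← pow_succ'] at h5
        have := relations.add_mem h5 h4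
        convert this using 1
        abel

end Nilpotence

/-- **Registered stub `stub_blowup_nilpotence`** (crux `CTConstruction`, line `registered`, reshape r4):
nilpotence of `T = 2β − 1` on the log block, explicit form of `blowupT_iterate_log`. [folklore] -/
theorem stub_blowup_nilpotence : ∀ (Tβ : (Σ n, Literature.NumberTheory.Transcendental.KZ.IntegralRep n) → Literature.NumberTheory.Transcendental.KZ.FormalRep), (∀ ρ : Literature.NumberTheory.Transcendental.KZ.IntegralRep 0, Tβ ⟨0, ρ⟩ = 0) → (∀ (n : ℕ) (ρ : Literature.NumberTheory.Transcendental.KZ.IntegralRep (n + 1)), ∃ ρ' : Literature.NumberTheory.Transcendental.KZ.IntegralRep (n + 1 + 1), Tβ ⟨n + 1, ρ⟩ = Literature.NumberTheory.Transcendental.KZ.of ρ' ∧ ρ'.domain = {z | 0 < z 1 ∧ z 1 < z 0 ∧ z 0 < 1 ∧ (fun i : Fin (n + 1) => z i.succ) ∈ ρ.domain} ∧ ρ'.integrand = fun z => z 1 / z 0 ^ 2 * ρ.integrand (fun i : Fin (n + 1) => z i.succ)) → ∀ (m : ℕ), (∀ (b q d : ℕ) (r : Literature.NumberTheory.Transcendental.KZ.IntegralRep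 d) (P : Literature.NumberTheory.Transcendental.KZ.IntegralRep (b + d + 1 + 1)), b < m → 0 < q → P.domain = {z | ∃ (s u : ℝ) (y : Fin b → ℝ) (w : Fin d → ℝ), z = Matrix.vecCons s (Matrix.vecCons u (Fin.append y w)) ∧ 0 < s ∧ s < 1 ∧ 0 < u ∧ u ^ q * s ^ 0 < 1 ∧ (∀ j, s ≤ y j ∧ y j ≤ 1) ∧ w ∈ r.domain} → P.integrand = (fun z => (∏ j : Fin b, (z (Fin.castAdd d j).succ.succ)⁻¹) * r.integrand (fun l : Fin d => z (Fin.natAdd b l).succ.succ)) → (fun x => 2 • FreeAbelianGroup.lift Tβ x - x)^[m] (Literature.NumberTheory.Transcendental.KZ.of P) ∈ Literature.NumberTheory.Transcendental.KZ.fibredRelations) ∧ (∀ (b q d : ℕ) (r : Literature.NumberTheory.Transcendental.KZ.IntegralRep d) (P : Literature.NumberTheory.Transcendental.KZ.IntegralRep (b + d + 1 + 1)), b = m → 0 < q → P.domain = {z | ∃ (s u : ℝ) (y : Fin b → ℝ) (w : Fin d → ℝ), z = Matrix.vecCons s (Matrix.vecCons u (Fin.append y w)) ∧ 0 < s ∧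 s < 1 ∧ 0 < u ∧ u ^ q * s ^ 0 < 1 ∧ (∀ j, s ≤ y j ∧ y j ≤ 1) ∧ w ∈ r.domain} → P.integrand = (fun z => (∏ j : Fin b, (z (Fin.castAdd d j).succ.succ)⁻¹) * r.integrand (fun l : Fin d => z (Fin.natAdd b l).succ.succ)) → ∃ (d' : ℕ) (W : Literature.NumberTheory.Transcendental.KZ.IntegralRep d') (C : Literature.NumberTheory.Transcendental.KZ.IntegralRep (0 + d' + 1 + 1)), C.domain = {z | ∃ (s u : ℝ) (y : Fin 0 → ℝ) (w : Fin d' → ℝ), z = Matrix.vecCons s (Matrix.vecCons u (Fin.append y w)) ∧ 0 < s ∧ s < 1 ∧ 0 < u ∧ u ^ q * s ^ 0 < 1 ∧ (∀ j, s ≤ y j ∧ y j ≤ 1) ∧ w ∈ W.domain} ∧ C.integrand = (fun z => (∏ j : Fin 0, (z (Fin.castAdd d' j).succ.succ)⁻¹) * W.integrand (fun l : Fin d' => z (Fin.natAdd 0 l).succ.succ)) ∧ (fun x => 2 • FreeAbelianGroup.lift Tβ x - x)^[m] (Literature.NumberTheory.Transcendental.KZ.of P) - (2 ^ m * m.factorial)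 • Literature.NumberTheory.Transcendental.KZ.of C ∈ Literature.NumberTheory.Transcendental.KZ.fibredRelations ∧ 4 ^ m • Literature.NumberTheory.Transcendental.KZ.of W - Literature.NumberTheory.Transcendental.KZ.of r ∈ Literature.NumberTheory.Transcendental.KZ.relations) :=
  fun _ hT0 hT m => blowupT_iterate_log hT0 hT m

end Summit.KontsevichZagierPeriods.ValuedFieldSpecialisation
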